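import Mathlib
import HarnessLib
import Summits.NavierStokesRegularity.NavierStokesRegularity.Theorems.TypeIQuarterGateScarEnvelopeTypeIForcedTsaiAlgMomentsAux

/-!
# ARM B lane E-exact, Type-I-tail class — the MOMENT IDENTITY behind `Poly5.integrate`
  (`∫_{ℝ³} c·y^a·(1+|y|²/τ²)^{−h/2} dy = c·Πᵢ Γ((aᵢ+1)/2)·τ^{|a|+3}·Γ((h−|a|−3)/2)/Γ(h/2)` for `h > |a|+3`,
  by Gamma subordination `(1+u)^{−r} = Γ(r)^{−1}∫₀^∞ s^{r−1}e^{−s(1+u)}ds` of the `ℝ³` Gaussian moments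
  of `…ForcedTsaiMoments`, Fubini on `ℝ³ × (0,∞)`), with integrability; the `Γ(n/2) ↔ ghalf n` bookkeeping;
  the list/pair bookkeeping of `Poly5.integrate`:
  `Poly5.integrate τ P = some (c₁, c₂) → Integrable (Poly5.eval τ P) ∧ ∫ Poly5.eval τ P = c₁·π + c₂·π²`.
Nothing here bears on NS regularity.
-/

noncomputable section

set_option linter.dupNamespace false

namespace Summit.NavierStokesRegularity.NavierStokesRegularity.Cruxes.ScarEnvelopeTypeI.ForcedTsai

open MeasureTheory Set Metric Real Finset
open scoped RealInnerProductSpace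

/-! ## The subordinated integrand on `ℝ³ × (0,∞)` -/

/-- `subF` is continuous (for `r ≥ 1`). -/
theorem continuous_subF (τ : ℝ) (m : Mono) {r : ℝ} (hr : 1 ≤ r) : Continuous (subF τ m r) := by
  unfold subF gauss
  refine ((( Mono.continuous_eval m).comp continuous_fst).mul (continuous_const.mul
    (((Real.continuous_rpow_const (by linarith)).comp continuous_snd).mul
      (Real.continuous_exp.comp continuous_snd.neg)))).mul ?_
  exact Real.continuous_exp.comp (((continuous_snd.div_const _).neg).mul ((continuous_norm.comp continuous_fst).pow 2))

/-- For `s > 0`, the `y`-slice of `subF` is integrable. -/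
theorem integrable_subF_slice (τ : ℝ) (hτ : 0 < τ) (m : Mono) (r : ℝ) {s : ℝ} (hs : 0 < s) :
    Integrable (fun y : E3 => subF τ m r (y, s)) := by
  have hb : 0 < s / τ ^ 2 := by positivity
  have := ((integral_mono_gauss_real m hb).1.const_mul ((Real.Gamma r)⁻¹ * (s ^ (r - 1) * Real.exp (-s))))
  refine this.congr (Filter.Eventually.of_forall fun y => ?_)
  simp only [subF]; ring

/-- For `s > 0`, the `y`-integral of `‖subF‖`. -/
theorem integral_norm_subF_slice (τ : ℝ) (hτ : 0 < τ) (m : Mono) {r : ℝ} (hr : 0 < r) {s : ℝ} (hs : 0 < s) :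
    ∫ y : E3, ‖subF τ m r (y, s)‖ =
      (Real.Gamma r)⁻¹ * (s ^ (r - 1) * Real.exp (-s)) *
        (|(m.c : ℝ)| * ∏ j : Fin 3, ((s / τ ^ 2) ^ (-((m.exp j : ℝ) + 1) / 2) * Real.Gamma (((m.exp j : ℝ) + 1) / 2))) := by
  have hb : 0 < s / τ ^ 2 := by positivity
  have hK : 0 ≤ (Real.Gamma r)⁻¹ * (s ^ (r - 1) * Real.exp (-s)) := by
    have := Real.Gamma_pos_of_pos hr
    have : 0 ≤ s ^ (r - 1) := Real.rpow_nonneg hs.le _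
    positivity
  have hfun : (fun y : E3 => ‖subF τ m r (y, s)‖) =
      fun y => ((Real.Gamma r)⁻¹ * (s ^ (r - 1) * Real.exp (-s))) * (|Mono.eval m y| * gauss (s / τ ^ 2) y) := by
    funext y
    rw [subF, Real.norm_eq_abs, abs_mul, abs_mul, abs_of_nonneg hK, abs_of_pos (gauss_pos _ _)]
    ring
  rw [hfun, integral_const_mul, (integral_abs_mono_gauss_real m hb).2]

/-- The rate algebra: `Π_j (s/τ²)^{−(a_j+1)/2} = (τ²)^{q} · s^{−q}`, `q = (|a|+3)/2`. -/
theorem prod_rpow_rate (τ : ℝ) (hτ : 0 < τ) (m : Mono) {s : ℝ} (hs : 0 < s) :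
    ∏ j : Fin 3, (s / τ ^ 2) ^ (-((m.exp j : ℝ) + 1) / 2) =
      (τ ^ 2) ^ ((((m.e1 + m.e2 + m.e3 : ℕ) : ℝ) + 3) / 2) * s ^ (-((((m.e1 + m.e2 + m.e3 : ℕ) : ℝ) + 3) / 2)) := by
  have hτ2 : 0 < τ ^ 2 := by positivity
  rw [Fin.prod_univ_three]
  simp only [Mono.exp]
  have hst : 0 < s / τ ^ 2 := by positivity
  rw [← Real.rpow_add hst, ← Real.rpow_add hst]
  have : -((m.e1 : ℝ) + 1) / 2 + -((m.e2 : ℝ) + 1) / 2 + -((m.e3 : ℝ) + 1) / 2 =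
      -((((m.e1 + m.e2 + m.e3 : ℕ) : ℝ) + 3) / 2) := by push_cast; ring
  rw [this, Real.div_rpow hs.le hτ2.le, Real.rpow_neg hs.le, Real.rpow_neg hτ2.le]
  field_simp

/-- `subF` is integrable on `ℝ³ × (0,∞)` when `r > q = (|a|+3)/2` (and `r ≥ 1`). -/
theorem integrable_subF (τ : ℝ) (hτ : 0 < τ) (m : Mono) {r : ℝ} (hr1 : 1 ≤ r)
    (hrq : (((m.e1 + m.e2 + m.e3 : ℕ) : ℝ) + 3) / 2 < r) : Integrable (subF τ m r) μP := by
  have hr : 0 < r := by linarith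
  set q : ℝ := (((m.e1 + m.e2 + m.e3 : ℕ) : ℝ) + 3) / 2 with hq
  have hcont := continuous_subF τ m hr1
  rw [μP, integrable_prod_iff' hcont.aestronglyMeasurable]
  constructor
  · refine (ae_restrict_mem measurableSet_Ioi).mono fun s hs => ?_
    exact integrable_subF_slice τ hτ m r hs
  · -- s ↦ ∫‖F(·,s)‖ equals C·s^{(r−q)−1}e^{−s} on (0,∞)
    set C : ℝ := (Real.Gamma r)⁻¹ * (|(m.c : ℝ)| * ((τ ^ 2) ^ q *
      ∏ j : Fin 3, Real.Gamma (((m.exp j : ℝ) + 1) / 2))) with hC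
    have hG : IntegrableOn (fun s : ℝ => C * (Real.exp (-s) * s ^ ((r - q) - 1))) (Ioi 0) :=
      (Real.GammaIntegral_convergent (by linarith : 0 < r - q)).const_mul C
    refine hG.congr_fun (fun s (hs : s ∈ Ioi (0:ℝ)) => ?_) measurableSet_Ioi
    have hs' : (0 : ℝ) < s := hs
    beta_reduce
    rw [integral_norm_subF_slice τ hτ m hr hs', Finset.prod_mul_distrib, prod_rpow_rate τ hτ m hs', ← hq, hC,
      show s ^ (r - q - 1) = s ^ (r - 1) * s ^ (-q) by rw [← Real.rpow_add hs']; ring_nf]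
    ring

/-- **The subordinated pointwise identity**: `c y^a v^h(y) = ∫₀^∞ subF(y,s) ds` (`h ≥ 1`). -/
theorem mono5_eq_integral_subF (τ : ℝ) (m : Mono5) (hh : 1 ≤ m.eh) (y : E3) :
    Mono5.eval τ { m with et := 0 } y = ∫ s in Ioi (0 : ℝ), subF τ m.yMono ((m.eh : ℝ) / 2) (y, s) := by
  have h1 : (1 : ℝ) ≤ (m.eh : ℝ) := by exact_mod_cast hh
  have hr : 0 < (m.eh : ℝ) / 2 := by linarith
  rw [Mono5.eval, pow_zero, mul_one, vpow, show (-(m.eh : ℝ) / 2) = -((m.eh : ℝ) / 2) by ring,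
    kbase_rpow_neg_eq_integral τ y hr, ← integral_const_mul, ← integral_const_mul]
  refine setIntegral_congr_fun measurableSet_Ioi fun s _ => ?_
  rw [subF, exp_neg_kbase_mul, Mono5.yMono, Mono.eval]
  simp only []
  ring

/-- For `s > 0`, the `y`-integral of `subF`: all exponents even. -/
theorem integral_subF_slice_even (τ : ℝ) (hτ : 0 < τ) (m : Mono) (r : ℝ) {s : ℝ} (hs : 0 < s)
    (he : m.e1 % 2 = 0 ∧ m.e2 % 2 = 0 ∧ m.e3 % 2 = 0) :
    ∫ y : E3, subF τ m r (y, s) =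
      (Real.Gamma r)⁻¹ * (s ^ (r - 1) * Real.exp (-s)) *
        ((m.c : ℝ) * (√π ^ 3 * ((ghalf (m.e1 + 1) : ℝ) * (ghalf (m.e2 + 1) : ℝ) * (ghalf (m.e3 + 1) : ℝ)) *
          ∏ j : Fin 3, (s / τ ^ 2) ^ (-((m.exp j : ℝ) + 1) / 2))) := by
  have hb : 0 < s / τ ^ 2 := by positivity
  have hfun : (fun y : E3 => subF τ m r (y, s)) =
      fun y => ((Real.Gamma r)⁻¹ * (s ^ (r - 1) * Real.exp (-s))) * (Mono.eval m y * gauss (s / τ ^ 2) y) := by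
    funext y; simp only [subF]; ring
  rw [hfun, integral_const_mul, (integral_mono_gauss_real m hb).2, Fin.prod_univ_three, Fin.prod_univ_three]
  simp only [Mono.exp]
  obtain ⟨h1, h2, h3⟩ := he
  obtain ⟨k1, hk1⟩ : ∃ k, m.e1 = 2 * k := ⟨m.e1 / 2, by omega⟩
  obtain ⟨k2, hk2⟩ : ∃ k, m.e2 = 2 * k := ⟨m.e2 / 2, by omega⟩
  obtain ⟨k3, hk3⟩ : ∃ k, m.e3 = 2 * k := ⟨m.e3 / 2, by omega⟩
  rw [hk1, hk2, hk3, integral_pow_even_gauss_ghalf k1 hb, integral_pow_even_gauss_ghalf k2 hb,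
    integral_pow_even_gauss_ghalf k3 hb]
  ring

/-- For `s > 0`, the `y`-integral of `subF` vanishes if some exponent is odd. -/
theorem integral_subF_slice_odd (τ : ℝ) (hτ : 0 < τ) (m : Mono) (r : ℝ) {s : ℝ} (hs : 0 < s)
    (ho : m.e1 % 2 = 1 ∨ m.e2 % 2 = 1 ∨ m.e3 % 2 = 1) :
    ∫ y : E3, subF τ m r (y, s) = 0 := by
  have hb : 0 < s / τ ^ 2 := by positivity
  have hfun : (fun y : E3 => subF τ m r (y, s)) =
      fun y => ((Real.Gamma r)⁻¹ * (s ^ (r - 1) * Real.exp (-s))) * (Mono.eval m y * gauss (s / τ ^ 2) y) := by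
    funext y; simp only [subF]; ring
  rw [hfun, integral_const_mul, (integral_mono_gauss_real m hb).2, Fin.prod_univ_three]
  simp only [Mono.exp]
  rcases ho with h1 | h2 | h3
  · obtain ⟨k, hk⟩ : ∃ k, m.e1 = 2 * k + 1 := ⟨m.e1 / 2, by omega⟩
    rw [hk, integral_pow_odd_mul_gauss1]; ring
  · obtain ⟨k, hk⟩ : ∃ k, m.e2 = 2 * k + 1 := ⟨m.e2 / 2, by omega⟩
    rw [hk, integral_pow_odd_mul_gauss1]; ring
  · obtain ⟨k, hk⟩ : ∃ k, m.e3 = 2 * k + 1 := ⟨m.e3 / 2, by omega⟩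
    rw [hk, integral_pow_odd_mul_gauss1]; ring

/-! ## The moment theorem for one 5-monomial -/

/-- **Moments of a convergent `t`-free 5-monomial**: integrable on `ℝ³`, with
`∫ c y^a v^h = momentQ · π^{1 or 2}` (`τ > 0`). -/
theorem integral_mono5 {τq : ℚ} (hτq : 0 < τq) (m : Mono5) (hconv : m.conv = true) :
    Integrable (fun y : E3 => Mono5.eval (τq : ℝ) m y) ∧
      ∫ y : E3, Mono5.eval (τq : ℝ) m y = m.momentR τq := by
  set τ : ℝ := (τq : ℝ) with hτdef
  have hτ : 0 < τ := by rw [hτdef]; exact_mod_cast hτq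
  simp only [Mono5.conv, Bool.and_eq_true, decide_eq_true_eq] at hconv
  obtain ⟨hlt, het⟩ := hconv
  have hm : m = { m with et := 0 } := by cases m; simp_all
  set A : ℕ := m.e1 + m.e2 + m.e3 with hA
  set h : ℕ := m.eh with hh
  set r : ℝ := (h : ℝ) / 2 with hr
  set q : ℝ := ((A : ℝ) + 3) / 2 with hq
  have hh4 : A + 4 ≤ h := by omega
  have hh1 : 1 ≤ m.eh := by omega
  have h4 : (4 : ℝ) ≤ (h : ℝ) := by exact_mod_cast (show 4 ≤ h by omega)
  have hr1 : 1 ≤ r := by rw [hr]; linarith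
  have hA4 : ((A : ℝ) + 4) ≤ h := by exact_mod_cast hh4
  have hrq : q < r := by rw [hq, hr]; linarith
  have hrpos : 0 < r := by linarith
  have hF := integrable_subF τ hτ m.yMono hr1 (by simpa [Mono5.yMono, ← hA] using hrq)
  -- pointwise: Mono5.eval = ∫_s subF
  have hpt : ∀ y, Mono5.eval τ m y = ∫ s in Ioi (0 : ℝ), subF τ m.yMono r (y, s) := by
    intro y; rw [hm]; exact mono5_eq_integral_subF τ m hh1 y
  have hfun : (fun y : E3 => Mono5.eval τ m y) = fun y => ∫ s in Ioi (0 : ℝ), subF τ m.yMono r (y, s) := funext hpt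
  constructor
  · rw [hfun]; exact hF.integral_prod_left
  · rw [hfun]
    have hswap := MeasureTheory.integral_integral_swap (f := fun (y : E3) (s : ℝ) => subF τ m.yMono r (y, s))
      (μ := (volume : Measure E3)) (ν := (volume : Measure ℝ).restrict (Ioi 0))
      (by simpa only [μP, Function.uncurry_def, Prod.mk.eta] using hF)
    rw [hswap]
    -- inner integral in y, then the Gamma integral in s
    by_cases he : m.e1 % 2 = 0 ∧ m.e2 % 2 = 0 ∧ m.e3 % 2 = 0
    · have hinner : ∀ s ∈ Ioi (0 : ℝ), ∫ y : E3, subF τ m.yMono r (y, s) =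
          ((Real.Gamma r)⁻¹ * ((m.c : ℝ) * (√π ^ 3 * ((ghalf (m.e1 + 1) : ℝ) * (ghalf (m.e2 + 1) : ℝ) *
            (ghalf (m.e3 + 1) : ℝ)) * (τ ^ 2) ^ q))) * (Real.exp (-s) * s ^ ((r - q) - 1)) := by
        intro s hs
        have hs' : (0 : ℝ) < s := hs
        rw [integral_subF_slice_even τ hτ m.yMono r hs' (by simpa [Mono5.yMono] using he),
          prod_rpow_rate τ hτ m.yMono hs']
        simp only [Mono5.yMono, ← hA, ← hq]
        rw [show s ^ (r - q - 1) = s ^ (r - 1) * s ^ (-q) by rw [← Real.rpow_add hs']; ring_nf]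
        ring
      rw [setIntegral_congr_fun measurableSet_Ioi hinner, integral_const_mul, ← Real.Gamma_eq_integral (by linarith)]
      -- assemble momentR
      rw [Mono5.momentR, Mono5.momentQ, if_neg (by omega)]
      have hd : h - (A + 3) = h - A - 3 := by omega
      have hGr : Real.Gamma r = (ghalf h : ℝ) * (if h % 2 = 1 then √π else 1) := by
        rw [hr]; exact Gamma_half_eq_ghalf h (by omega)
      have hGd : Real.Gamma (r - q) = (ghalf (h - (A + 3)) : ℝ) * (if (h - (A + 3)) % 2 = 1 then √π else 1) := by
        have : r - q = (((h - (A + 3) : ℕ) : ℝ)) / 2 := by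
          rw [hr, hq, Nat.cast_sub (by omega)]; push_cast; ring
        rw [this]; exact Gamma_half_eq_ghalf _ (by omega)
      have hτ2q : (τ ^ 2) ^ q = τ ^ (A + 3) := by
        rw [← Real.rpow_natCast τ 2, ← Real.rpow_mul hτ.le, hq, ← Real.rpow_natCast]
        congr 1; push_cast; ring
      have hA_even : A % 2 = 0 := by omega
      have hsqrtpi : √π ^ 2 = π := Real.sq_sqrt Real.pi_pos.le
      have hs3 : √π ^ 3 = π * √π := by rw [pow_succ, hsqrtpi]
      have hsp : √π ≠ 0 := (Real.sqrt_pos.2 Real.pi_pos).ne'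
      push_cast
      rw [← hA, ← hh, ← hτdef, hGr, hGd, hτ2q, hs3]
      by_cases hpar : h % 2 = 1
      · rw [if_pos hpar, if_neg (by omega), if_pos hpar]
        have hgh : (ghalf h : ℝ) ≠ 0 := by
          rw [show h = 2 * (h / 2) + 1 by omega, ghalf_odd_cast]
          exact Finset.prod_ne_zero_iff.mpr fun i _ => by positivity
        field_simp
      · rw [if_neg hpar, if_pos (by omega), if_neg hpar,
          show π ^ 2 = π * √π * √π by rw [mul_assoc, ← sq, hsqrtpi, sq]]
        have hgh : (ghalf h : ℝ) ≠ 0 := by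
          rw [show h = 2 * (h / 2) by omega, ghalf_even]
          exact_mod_cast Nat.factorial_ne_zero _
        field_simp
    · have ho : m.e1 % 2 = 1 ∨ m.e2 % 2 = 1 ∨ m.e3 % 2 = 1 := by omega
      have hinner : ∀ s ∈ Ioi (0 : ℝ), ∫ y : E3, subF τ m.yMono r (y, s) = 0 := fun s hs =>
        integral_subF_slice_odd τ hτ m.yMono r hs (by simpa [Mono5.yMono] using ho)
      rw [setIntegral_congr_fun measurableSet_Ioi hinner, integral_zero, Mono5.momentR, Mono5.momentQ, if_pos ho]
      simp

/-! ## Lists: `Poly5.integrate` -/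

/-- The pair fold of `Poly5.integrate`, as two sums. -/
theorem integrate_foldl_eq (τ : ℚ) (E : Poly5) (a : ℚ × ℚ) :
    E.foldl (fun acc m => if m.eh % 2 = 1 then (acc.1 + m.momentQ τ, acc.2) else (acc.1, acc.2 + m.momentQ τ)) a =
      (a.1 + (E.map fun m => if m.eh % 2 = 1 then m.momentQ τ else 0).sum,
        a.2 + (E.map fun m => if m.eh % 2 = 1 then 0 else m.momentQ τ).sum) := by
  induction E generalizing a with
  | nil => simp
  | cons m E ih =>
    rw [List.foldl_cons, ih, List.map_cons, List.map_cons, List.sum_cons, List.sum_cons]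
    by_cases hm : m.eh % 2 = 1
    · simp only [hm, ↓reduceIte]; ext
      · simp; ring
      · simp
    · simp only [hm, ↓reduceIte]; ext
      · simp
      · simp; ring

/-- All-convergent lists are integrable with the summed moments. -/
theorem integral_list_mono5 {τq : ℚ} (hτq : 0 < τq) (E : Poly5) (hall : E.all Mono5.conv = true) :
    Integrable (fun y : E3 => Poly5.eval (τq : ℝ) E y) ∧
      ∫ y : E3, Poly5.eval (τq : ℝ) E y = (E.map fun m => m.momentR τq).sum := by
  induction E with
  | nil => simp
  | cons m E ih =>
    rw [List.all_cons, Bool.and_eq_true] at hall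
    obtain ⟨hmi, hmv⟩ := integral_mono5 hτq m hall.1
    obtain ⟨hEi, hEv⟩ := ih hall.2
    have hsplit : (fun y : E3 => Poly5.eval (τq : ℝ) (m :: E) y) =
        fun y => Mono5.eval (τq : ℝ) m y + Poly5.eval (τq : ℝ) E y := by funext y; rw [Poly5.eval_cons]
    rw [hsplit]
    refine ⟨hmi.add hEi, ?_⟩
    rw [integral_add hmi hEi, hmv, hEv, List.map_cons, List.sum_cons]

/-- The summed real moments are `c₁·π + c₂·π²`. -/
theorem sum_momentR_eq (τ : ℚ) (E : Poly5) :
    (E.map fun m => m.momentR τ).sum =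
      (((E.map fun m => if m.eh % 2 = 1 then m.momentQ τ else 0).sum : ℚ) : ℝ) * π +
        (((E.map fun m => if m.eh % 2 = 1 then 0 else m.momentQ τ).sum : ℚ) : ℝ) * π ^ 2 := by
  induction E with
  | nil => simp
  | cons m E ih =>
    rw [List.map_cons, List.sum_cons, ih, List.map_cons, List.map_cons, List.sum_cons, List.sum_cons]
    unfold Mono5.momentR
    by_cases hm : m.eh % 2 = 1
    · simp only [hm, ↓reduceIte]; push_cast; ring
    · simp only [hm, ↓reduceIte]; push_cast; ring

/-- **`Poly5.integrate` is sound**: `integrate τ P = some (c₁,c₂)` gives integrability of `Poly5.eval τ P`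
on `ℝ³` and `∫ Poly5.eval τ P = c₁·π + c₂·π²` (`τ > 0`). -/
theorem integral_poly5 {τq : ℚ} (hτq : 0 < τq) (P : Poly5) {c : ℚ × ℚ} (hP : Poly5.integrate τq P = some c) :
    Integrable (fun y : E3 => Poly5.eval (τq : ℝ) P y) ∧
      ∫ y : E3, Poly5.eval (τq : ℝ) P y = (c.1 : ℝ) * π + (c.2 : ℝ) * π ^ 2 := by
  unfold Poly5.integrate at hP
  simp only [] at hP
  split_ifs at hP with hall
  cases hP
  obtain ⟨hi, hv⟩ := integral_list_mono5 hτq (Poly5.expandT P) hall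
  have hfun : (fun y : E3 => Poly5.eval (τq : ℝ) P y) = fun y => Poly5.eval (τq : ℝ) (Poly5.expandT P) y :=
    funext fun y => (Poly5.eval_expandT _ P y).symm
  rw [hfun]
  refine ⟨hi, ?_⟩
  rw [hv, sum_momentR_eq, integrate_foldl_eq]
  simp

end Summit.NavierStokesRegularity.NavierStokesRegularity.Cruxes.ScarEnvelopeTypeI.ForcedTsai

end
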